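import Summits.MatrixMultiplication.OmegaCensus.ThreeSetZ5Z5CoverKitE3Split
import Summits.MatrixMultiplication.OmegaCensus.DominoZ5Z5Data19S5
import HarnessLib

/-!
# Three-margin cover computations for `(1,9,12)@325`, hole class `σ = 5`, flagged row `14`, column group `1` (part B of 3)

ω-census `pub-omega`, family (b3), seat pub-omega-group gen 38 (format of gen 37's staged files).  Framing: lottery ticket; floor = certified
bounds/negative ranges.  VALUE: kernel computations of the `ℤ₅²` stage of the census cell `(1,9,12)@325` of `ℤ₅ × ℤ₆₅`
(design `HOME/pub-omega-group-g37/DESIGN-1-9-12.md`); NOT progress on ω.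
Each `decide + kernel` covers ONE flagged row-sum vector and ONE group of `8` flagged column vectors over all `32` flagged diagonal vectors.
File sizing by the node-count model `HOME/pub-omega-group-g38/code/rowcost.py` (gate verify time ≈ 1 ms per `rowsEnumE3` node; budget 600 s):
rows above 420k nodes are split into two files (column groups `0,1` / `2,3`), rows above 640k into three (`0,3` / `1` / `2`),
and recombined in the assembly file.
This row: 669502 enumeration nodes in the model — split.
-/

namespace Summit.MatrixMultiplication.OmegaCensus

namespace Z5Z5ThreeSet

open ZpZpDomino

set_option maxRecDepth 100000 in
set_option maxHeartbeats 4000000 in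
/-- Cover computation: flagged row `14`, column group `1`. [folklore] -/
theorem cov19s5_r14_c1 : coverGenE3 tree19s5 exc19s5 10 (rowWs 5 10) (diagIdx 5) [flR19s5.getD 14 []] (flCg19s5.getD 1 [])
    flD19s5 (offs 5 10) (off 5 10 1) (off 5 10 2) = true := by decide +kernel

end Z5Z5ThreeSet

end Summit.MatrixMultiplication.OmegaCensus
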